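import Mathlib
import HarnessLib
import Summits.NavierStokesRegularity.NavierStokesRegularity.Theorems.PoloidalWindowDoorPoloidalWindowRigidityRieszCollapse
import Summits.NavierStokesRegularity.NavierStokesRegularity.Theorems.PoloidalWindowDoorPoloidalWindowRigidityHorizontalDet
import Summits.NavierStokesRegularity.NavierStokesRegularity.Theorems.PoloidalWindowDoorPoloidalWindowRigiditySignedCollapse

/-!
# Route `PoloidalWindowDoor`, crux `PoloidalWindowRigidity` (stmt-19708), LINE 9 `sonic_cut` of ns-idea-8: STUB T1 `stub_pairingCollapse` —
# THE PAIRING `Q₃ = ⟨∂₂v, ∇v₂⟩` CANNOT KEEP A SIGN ON A SLICE UNLESS IT VANISHES (price P9-1 of idea-crit-7 g3)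

Seat ns-poloidal-K2-p2 g10 (LEAD-lineage on 19708; file `--supports`).  On a slice `s < 0` of a profile of the route's Type-I class, poloidal
along `e₃`, write `A_ab = ∂_a v_b = Dv(e_a)_b`.  The pairing `Q₃ := A₂₀A₀₂ + A₂₁A₁₂ + A₂₂²` satisfies, pointwise on trace-free (`div v = 0`)
poloidal (`A₀₁ = A₁₀`) Jacobians,

  `Q₃ = det ∇ₕvₕ + ½ tr((Dv)²)`,   `det ∇ₕvₕ = A₀₀A₁₁ − A₁₀A₀₁`,   `tr((Dv)²) = Σᵢ ⟪eᵢ, Dv(Dv eᵢ)⟫`   (`…StrainGrowth.trace_sq_of_poloidal`),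

and BOTH summands are second-order null Lagrangians BY NAME: `…HorizontalDet.integral_mul_jacobian_eq` (p652990; `a = v₀`, `b = v₁`, `p = e₀`,
`q = e₁`, symmetry `∂₀v₁ = ∂₁v₀`) and `…RieszCollapse.integral_mul_traceSq_eq_integral_hessian` (p650966).  Against the tree cut-off `cutoff R`
(`‖D∇ cutoff R‖ ≤ C₂/R²`) and with S1 (`∫_{B(0,3R)}|v(s)|² ≤ 3KR`, p633959) this gives `|∫ cutoff R · Q₃(s)| ≤ M/R`
(`abs_integral_cutoff_mul_pairing_le_of_class`), and a signed `Q₃(s,·)` then vanishes identically by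
`…SignedCollapse.eq_zero_of_sign_of_abs_integral_cutoff_mul_le` (p652558): `stub_pairingCollapse`, statement VERBATIM from
`Cruxes/PoloidalWindowRigidity/Lines/sonic_cut.lean` (l. 133–146).  (M) is consumed through S1.

WHAT THIS IS NOT: not a claim about Navier–Stokes regularity; the LEVER of LINE 9 for hypothetical Type-I profiles (bears_on LADDER-NS N0 via
crux 19708); T2/T3 of the line remain research. [folklore]
-/

noncomputable section

-- the summit and its single sub-problem share the name (CONVENTIONS §1), as in every Theorems file
set_option linter.dupNamespace false

namespace Summit.NavierStokesRegularity.NavierStokesRegularity.Theorems.PoloidalWindowDoorPoloidalWindowRigidityPairingCollapse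

open MeasureTheory Set Function Filter Topology Metric InnerProductSpace
open scoped RealInnerProductSpace
open Literature.Analysis Literature.Analysis.FluidPDE
open Summit.NavierStokesRegularity.NavierStokesRegularity.Theorems.PoloidalWindowDoorPoloidalWindowRigidityWindow
open Summit.NavierStokesRegularity.NavierStokesRegularity.Theorems.PoloidalWindowDoorPoloidalWindowRigidityStrainGrowth
open Summit.NavierStokesRegularity.NavierStokesRegularity.Theorems.PoloidalWindowDoorPoloidalWindowRigiditySparseEnergyScaledEnergy
open Summit.NavierStokesRegularity.NavierStokesRegularity.Theorems.PoloidalWindowDoorPoloidalWindowRigidityRieszCollapse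
open Summit.NavierStokesRegularity.NavierStokesRegularity.Theorems.PoloidalWindowDoorPoloidalWindowRigidityHorizontalDet
open Summit.NavierStokesRegularity.NavierStokesRegularity.Theorems.PoloidalWindowDoorPoloidalWindowRigiditySignedCollapse

/-! ### Pointwise algebra: `Q₃ = det ∇ₕvₕ + ½ tr((Dv)²)` -/

/-- On a trace-free Jacobian with `L(e₀)₁ = L(e₁)₀`:  `L(e₂)₀L(e₀)₂ + L(e₂)₁L(e₁)₂ + L(e₂)₂² = (L(e₀)₀L(e₁)₁ − L(e₁)₀L(e₀)₁) + ½ Σᵢ⟪eᵢ, L(L eᵢ)⟫`.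
[folklore] -/
theorem pairing_eq_det_add_half_trace (L : EuclideanSpace ℝ (Fin 3) →L[ℝ] EuclideanSpace ℝ (Fin 3))
    (htr : L (EuclideanSpace.single 0 (1 : ℝ)) 0 + L (EuclideanSpace.single 1 (1 : ℝ)) 1 + L (EuclideanSpace.single 2 (1 : ℝ)) 2 = 0)
    (hω : L (EuclideanSpace.single 0 (1 : ℝ)) 1 = L (EuclideanSpace.single 1 (1 : ℝ)) 0) :
    L (EuclideanSpace.single 2 (1 : ℝ)) 0 * L (EuclideanSpace.single 0 (1 : ℝ)) 2 +
        L (EuclideanSpace.single 2 (1 : ℝ)) 1 * L (EuclideanSpace.single 1 (1 : ℝ)) 2 + L (EuclideanSpace.single 2 (1 : ℝ)) 2 ^ 2 =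
      (L (EuclideanSpace.single 0 (1 : ℝ)) 0 * L (EuclideanSpace.single 1 (1 : ℝ)) 1 -
          L (EuclideanSpace.single 1 (1 : ℝ)) 0 * L (EuclideanSpace.single 0 (1 : ℝ)) 1) +
        1 / 2 * ∑ i : Fin 3, ⟪(EuclideanSpace.single i (1 : ℝ) : EuclideanSpace ℝ (Fin 3)), L (L (EuclideanSpace.single i (1 : ℝ)))⟫ := by
  rw [trace_sq_of_poloidal L hω]
  have h2 : L (EuclideanSpace.single 2 (1 : ℝ)) 2 = -(L (EuclideanSpace.single 0 (1 : ℝ)) 0 + L (EuclideanSpace.single 1 (1 : ℝ)) 1) := by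
    linarith
  rw [hω, h2]
  ring

/-! ### Calculus of the cut-off: second directional derivatives -/

/-- `∂_q∂_p χ (x) = ⟪D(∇χ)(x) q, p⟫` for `χ ∈ C²`. [folklore] -/
theorem fderiv_fderiv_apply_eq_inner {χ : EuclideanSpace ℝ (Fin 3) → ℝ} (hχ : ContDiff ℝ 2 χ) (x p q : EuclideanSpace ℝ (Fin 3)) :
    fderiv ℝ (fun y => fderiv ℝ χ y p) x q = ⟪fderiv ℝ (gradient χ) x q, p⟫ := by
  have hg1 : ContDiff ℝ 1 (gradient χ) :=
    (InnerProductSpace.toDual ℝ (EuclideanSpace ℝ (Fin 3))).symm.contDiff.comp (hχ.fderiv_right (m := 1) le_rfl)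
  have hfun : (fun y => fderiv ℝ χ y p) = fun y => ⟪gradient χ y, p⟫ := by
    funext y
    rw [gradient, InnerProductSpace.toDual_symm_apply]
  rw [hfun, fderiv_inner_apply ℝ ((hg1.differentiable one_ne_zero) x) (differentiableAt_const p)]
  simp

/-- The second directional derivatives of `cutoff R` are `O(R⁻²)` and vanish off `B̄(0,2R)`. [folklore] -/
theorem exists_abs_fderiv_fderiv_cutoff_le :
    ∃ C₂ : ℝ, 0 ≤ C₂ ∧ ∀ R : ℝ, 0 < R → ∀ p q : EuclideanSpace ℝ (Fin 3), ‖p‖ ≤ 1 → ‖q‖ ≤ 1 →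
      (∀ x, |fderiv ℝ (fun y => fderiv ℝ (cutoff (E := EuclideanSpace ℝ (Fin 3)) R) y p) x q| ≤ C₂ / R ^ 2) ∧
      ∀ x ∉ closedBall (0 : EuclideanSpace ℝ (Fin 3)) (2 * R),
        fderiv ℝ (fun y => fderiv ℝ (cutoff (E := EuclideanSpace ℝ (Fin 3)) R) y p) x q = 0 := by
  obtain ⟨C₂, hC₂0, hC₂⟩ := exists_norm_fderiv_gradient_cutoff_le
  refine ⟨C₂, hC₂0, fun R hR p q hp hq => ⟨fun x => ?_, fun x hx => ?_⟩⟩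
  · rw [fderiv_fderiv_apply_eq_inner (contDiff_cutoff (n := 2) R)]
    calc |⟪fderiv ℝ (gradient (cutoff (E := EuclideanSpace ℝ (Fin 3)) R)) x q, p⟫|
        ≤ ‖fderiv ℝ (gradient (cutoff (E := EuclideanSpace ℝ (Fin 3)) R)) x q‖ * ‖p‖ := abs_real_inner_le_norm _ _
      _ ≤ ‖fderiv ℝ (gradient (cutoff (E := EuclideanSpace ℝ (Fin 3)) R)) x‖ * ‖q‖ * ‖p‖ := by
          gcongr; exact ContinuousLinearMap.le_opNorm _ _
      _ ≤ C₂ / R ^ 2 * ‖q‖ * ‖p‖ := by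
          gcongr
          exact hC₂ R hR x
      _ ≤ C₂ / R ^ 2 * 1 * 1 := by
          gcongr
      _ = C₂ / R ^ 2 := by ring
  · have hx' : x ∉ tsupport (cutoff (E := EuclideanSpace ℝ (Fin 3)) R) := fun h' => hx (FluidPDE.tsupport_cutoff_subset hR h')
    have hev : (fun y => fderiv ℝ (cutoff (E := EuclideanSpace ℝ (Fin 3)) R) y p) =ᶠ[𝓝 x] fun _ => 0 := by
      filter_upwards [(isClosed_tsupport _).isOpen_compl.mem_nhds hx'] with y hy
      simp [fderiv_of_notMem_tsupport ℝ hy]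
    rw [hev.fderiv_eq]
    simp

/-! ### The class bound `|∫ cutoff R · Q₃(s)| ≤ M/R` -/

variable {C : ℝ} {v : ℝ → EuclideanSpace ℝ (Fin 3) → EuclideanSpace ℝ (Fin 3)}

/-- Coordinates of a slice are `C²` and their directional derivatives are the Jacobian entries. [folklore] -/
theorem coord_contDiff_fderiv {u : EuclideanSpace ℝ (Fin 3) → EuclideanSpace ℝ (Fin 3)} (hu : ContDiff ℝ 2 u) (k : Fin 3) :
    ContDiff ℝ 2 (fun x => u x k) ∧ ∀ x w, fderiv ℝ (fun x => u x k) x w = fderiv ℝ u x w k := by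
  refine ⟨contDiff_euclidean.1 hu k, fun x w => ?_⟩
  have hd : DifferentiableAt ℝ u x := hu.differentiable (by norm_num) x
  have h := ((EuclideanSpace.proj k : EuclideanSpace ℝ (Fin 3) →L[ℝ] ℝ).hasFDerivAt.comp x hd.hasFDerivAt).fderiv
  have e : ((EuclideanSpace.proj k : EuclideanSpace ℝ (Fin 3) →L[ℝ] ℝ) ∘ u) = fun x => u x k := rfl
  rw [e] at h
  rw [h]
  rfl

/-- **`|∫ cutoff R · Q₃(s)| ≤ M/R`** on every slice `s < 0` of a class profile poloidal along `e₃`, for every `R > 0`. [folklore] -/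
theorem abs_integral_cutoff_mul_pairing_le_of_class (hrate : HasTypeITimeDecay C v)
    (hcont : ContinuousOn (uncurry v) (Iio (0 : ℝ) ×ˢ univ))
    (hmild : ∀ s t : ℝ, s < t → t < 0 → ∀ x,
      v t x = UnboundedOperators.heatExtension (v s) (t - s) x - oseenDuhamel 1 s v v t x)
    (hdiv : ∀ t < 0, VectorCalculus.IsDivFree (v t))
    (hpol : ∀ s < 0, ∀ y, ⟪curl (v s) y, EuclideanSpace.single 2 1⟫ = 0) :
    ∃ M : ℝ, 0 ≤ M ∧ ∀ s : ℝ, s < 0 → ∀ R : ℝ, 0 < R →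
      |∫ x, cutoff (E := EuclideanSpace ℝ (Fin 3)) R x *
          (fderiv ℝ (v s) x (EuclideanSpace.single 2 1) 0 * fderiv ℝ (v s) x (EuclideanSpace.single 0 1) 2 +
            fderiv ℝ (v s) x (EuclideanSpace.single 2 1) 1 * fderiv ℝ (v s) x (EuclideanSpace.single 1 1) 2 +
            fderiv ℝ (v s) x (EuclideanSpace.single 2 1) 2 ^ 2)| ≤ M / R := by
  obtain ⟨M₁, hM₁0, hM₁⟩ := abs_integral_cutoff_mul_traceSq_le_of_class hrate hcont hmild hdiv
  obtain ⟨K, hK0, hK⟩ := scaledEnergy hrate hcont hmild hdiv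
  obtain ⟨C₂, hC₂0, hC₂⟩ := exists_abs_fderiv_fderiv_cutoff_le
  refine ⟨6 * C₂ * K + M₁ / 2, by positivity, fun s hs R hR => ?_⟩
  -- the slice and its horizontal coordinates
  have h2s : 2 * s < 0 := by linarith
  have hv2 : ContDiff ℝ 2 (v s) := by
    obtain ⟨p, hcl⟩ := (isTypeIAncientMild_of_class hrate hcont hmild hdiv).exists_isClassicalNSSolutionOn_Ioo h2s
    exact (hcl.contDiff_velocity ⟨by linarith, hs⟩).of_le (by norm_cast)
  have hvc : Continuous (v s) := hv2.continuous
  have hDc : Continuous fun x => fderiv ℝ (v s) x := hv2.continuous_fderiv (by norm_num)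
  obtain ⟨ha, hDa⟩ := coord_contDiff_fderiv hv2 0
  obtain ⟨hb, hDb⟩ := coord_contDiff_fderiv hv2 1
  -- incompressibility and poloidality in coordinates
  have htr : ∀ x, fderiv ℝ (v s) x (EuclideanSpace.single 0 1) 0 + fderiv ℝ (v s) x (EuclideanSpace.single 1 1) 1 +
      fderiv ℝ (v s) x (EuclideanSpace.single 2 1) 2 = 0 := by
    intro x
    have h := hdiv s hs x
    rw [divergence_eq_sum_inner_fderiv (EuclideanSpace.basisFun (Fin 3) ℝ)] at h
    simpa [Fin.sum_univ_three, EuclideanSpace.basisFun_apply, EuclideanSpace.inner_single_left] using h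
  have hω : ∀ x, fderiv ℝ (v s) x (EuclideanSpace.single 0 1) 1 = fderiv ℝ (v s) x (EuclideanSpace.single 1 1) 0 := by
    intro x
    have h := hpol s hs x
    rw [EuclideanSpace.inner_single_right, curl_apply_two] at h
    simp only [one_mul, map_sub, RCLike.conj_to_real] at h
    linarith
  -- pointwise splitting `Q₃ = det + ½ e`
  have hsplit : ∀ x, cutoff (E := EuclideanSpace ℝ (Fin 3)) R x *
      (fderiv ℝ (v s) x (EuclideanSpace.single 2 1) 0 * fderiv ℝ (v s) x (EuclideanSpace.single 0 1) 2 +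
        fderiv ℝ (v s) x (EuclideanSpace.single 2 1) 1 * fderiv ℝ (v s) x (EuclideanSpace.single 1 1) 2 +
        fderiv ℝ (v s) x (EuclideanSpace.single 2 1) 2 ^ 2) =
      cutoff (E := EuclideanSpace ℝ (Fin 3)) R x *
          (fderiv ℝ (fun y => v s y 0) x (EuclideanSpace.single 0 1) * fderiv ℝ (fun y => v s y 1) x (EuclideanSpace.single 1 1) -
            fderiv ℝ (fun y => v s y 0) x (EuclideanSpace.single 1 1) * fderiv ℝ (fun y => v s y 1) x (EuclideanSpace.single 0 1)) +
        1 / 2 * (cutoff (E := EuclideanSpace ℝ (Fin 3)) R x * ∑ i : Fin 3, ⟪(EuclideanSpace.single i (1 : ℝ) : EuclideanSpace ℝ (Fin 3)),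
          fderiv ℝ (v s) x (fderiv ℝ (v s) x (EuclideanSpace.single i (1 : ℝ)))⟫) := by
    intro x
    rw [pairing_eq_det_add_half_trace (fderiv ℝ (v s) x) (htr x) (hω x), hDa, hDa, hDb, hDb, ← hω x]
    ring
  -- integrability
  have hφc : HasCompactSupport (cutoff (E := EuclideanSpace ℝ (Fin 3)) R) := hasCompactSupport_cutoff hR
  have hφ : Continuous (cutoff (E := EuclideanSpace ℝ (Fin 3)) R) := (contDiff_cutoff (n := 0) R).continuous
  have cA : ∀ i j : Fin 3, Continuous fun x => fderiv ℝ (v s) x (EuclideanSpace.single i 1) j := fun i j =>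
    (contDiff_euclidean.1 ((hv2.fderiv_right (m := 0) (by norm_num)).clm_apply contDiff_const) j).continuous
  have hIdet : Integrable fun x => cutoff (E := EuclideanSpace ℝ (Fin 3)) R x *
      (fderiv ℝ (fun y => v s y 0) x (EuclideanSpace.single 0 1) * fderiv ℝ (fun y => v s y 1) x (EuclideanSpace.single 1 1) -
        fderiv ℝ (fun y => v s y 0) x (EuclideanSpace.single 1 1) * fderiv ℝ (fun y => v s y 1) x (EuclideanSpace.single 0 1)) := by
    simp_rw [hDa, hDb]
    exact (hφ.mul (((cA 0 0).mul (cA 1 1)).sub ((cA 1 0).mul (cA 0 1)))).integrable_of_hasCompactSupport hφc.mul_right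
  have hIe : Integrable fun x => 1 / 2 * (cutoff (E := EuclideanSpace ℝ (Fin 3)) R x * ∑ i : Fin 3,
      ⟪(EuclideanSpace.single i (1 : ℝ) : EuclideanSpace ℝ (Fin 3)), fderiv ℝ (v s) x (fderiv ℝ (v s) x (EuclideanSpace.single i (1 : ℝ)))⟫) :=
    ((hφ.mul (continuous_finsetSum _ fun i _ => continuous_const.inner (hDc.clm_apply (hDc.clm_apply continuous_const)))).integrable_of_hasCompactSupport
      hφc.mul_right).const_mul _
  rw [integral_congr_ae (Eventually.of_forall hsplit), integral_add hIdet hIe, MeasureTheory.integral_const_mul]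
  -- the trace part
  have he := hM₁ s hs R hR
  -- the Jacobian part: second-order form
  have hsym : ∀ x, fderiv ℝ (fun y => v s y 1) x (EuclideanSpace.single 0 1) = fderiv ℝ (fun y => v s y 0) x (EuclideanSpace.single 1 1) := by
    intro x; rw [hDa, hDb]; exact hω x
  have hJ := integral_mul_jacobian_eq ha hb (contDiff_cutoff (n := 2) R) hφc hsym
  rw [hJ]
  -- bounds for the three second-order integrals
  set B : Set (EuclideanSpace ℝ (Fin 3)) := closedBall (0 : EuclideanSpace ℝ (Fin 3)) (2 * R) with hB
  have hS1 : ∫ x in B, ‖v s x‖ ^ 2 ≤ K * (3 * R) := by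
    have hb := (hK s hs 0 (3 * R) (by positivity)).1
    have hint3 : IntegrableOn (fun x => ‖v s x‖ ^ 2) (ball (0 : EuclideanSpace ℝ (Fin 3)) (3 * R)) :=
      ((hvc.norm.pow 2).continuousOn.integrableOn_compact (isCompact_closedBall 0 (3 * R))).mono_set ball_subset_closedBall
    rw [← ofReal_integral_eq_lintegral_ofReal hint3 (ae_of_all _ fun x => sq_nonneg _)] at hb
    have h3 := (ENNReal.ofReal_le_ofReal_iff (by positivity)).1 hb
    exact (setIntegral_mono_set hint3 (ae_of_all _ fun x => sq_nonneg _)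
      (ae_of_all _ (closedBall_subset_ball (by linarith) : B ⊆ ball (0 : EuclideanSpace ℝ (Fin 3)) (3 * R)))).trans h3
  have hintB : IntegrableOn (fun x => ‖v s x‖ ^ 2) B := (hvc.norm.pow 2).continuousOn.integrableOn_compact (isCompact_closedBall _ _)
  have he0 : ‖(EuclideanSpace.single 0 (1 : ℝ) : EuclideanSpace ℝ (Fin 3))‖ ≤ 1 := by simp
  have he1 : ‖(EuclideanSpace.single 1 (1 : ℝ) : EuclideanSpace ℝ (Fin 3))‖ ≤ 1 := by simp
  -- generic bound: `|∫ g · ∂∂χ| ≤ (C₂/R²) ∫_B |v|²` whenever `|g| ≤ |v|²`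
  have hgen : ∀ (g : EuclideanSpace ℝ (Fin 3) → ℝ) (p q : EuclideanSpace ℝ (Fin 3)), Continuous g → (∀ x, |g x| ≤ ‖v s x‖ ^ 2) →
      ‖p‖ ≤ 1 → ‖q‖ ≤ 1 →
      |∫ x, g x * fderiv ℝ (fun y => fderiv ℝ (cutoff (E := EuclideanSpace ℝ (Fin 3)) R) y p) x q| ≤ C₂ / R ^ 2 * (K * (3 * R)) := by
    intro g p q hg hgv hp hq
    obtain ⟨hb', hz'⟩ := hC₂ R hR p q hp hq
    have hzero : ∀ x ∉ B, g x * fderiv ℝ (fun y => fderiv ℝ (cutoff (E := EuclideanSpace ℝ (Fin 3)) R) y p) x q = 0 :=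
      fun x hx => by rw [hz' x hx, mul_zero]
    rw [← setIntegral_eq_integral_of_forall_compl_eq_zero hzero]
    have hcont2 : Continuous fun x => fderiv ℝ (fun y => fderiv ℝ (cutoff (E := EuclideanSpace ℝ (Fin 3)) R) y p) x q :=
      ((((contDiff_cutoff (n := 2) R).fderiv_right (m := 1) le_rfl).clm_apply contDiff_const).continuous_fderiv one_ne_zero).clm_apply
        continuous_const
    have hIi : IntegrableOn (fun x => g x * fderiv ℝ (fun y => fderiv ℝ (cutoff (E := EuclideanSpace ℝ (Fin 3)) R) y p) x q) B :=
      (hg.mul hcont2).continuousOn.integrableOn_compact (isCompact_closedBall _ _)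
    have hpt : ∀ x ∈ B, ‖g x * fderiv ℝ (fun y => fderiv ℝ (cutoff (E := EuclideanSpace ℝ (Fin 3)) R) y p) x q‖ ≤ C₂ / R ^ 2 * ‖v s x‖ ^ 2 := by
      intro x _
      rw [norm_mul, Real.norm_eq_abs, Real.norm_eq_abs]
      calc |g x| * |fderiv ℝ (fun y => fderiv ℝ (cutoff (E := EuclideanSpace ℝ (Fin 3)) R) y p) x q|
          ≤ ‖v s x‖ ^ 2 * (C₂ / R ^ 2) := mul_le_mul (hgv x) (hb' x) (abs_nonneg _) (sq_nonneg _)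
        _ = C₂ / R ^ 2 * ‖v s x‖ ^ 2 := by ring
    calc |∫ x in B, g x * fderiv ℝ (fun y => fderiv ℝ (cutoff (E := EuclideanSpace ℝ (Fin 3)) R) y p) x q|
        ≤ ∫ x in B, C₂ / R ^ 2 * ‖v s x‖ ^ 2 := by
          rw [← Real.norm_eq_abs]
          exact (norm_integral_le_integral_norm _).trans (setIntegral_mono_on hIi.norm (hintB.const_mul _) measurableSet_closedBall hpt)
      _ = C₂ / R ^ 2 * ∫ x in B, ‖v s x‖ ^ 2 := integral_const_mul _ _
      _ ≤ C₂ / R ^ 2 * (K * (3 * R)) := by gcongr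
  -- the three Jacobian integrals
  have hn0 : ∀ x, |v s x 0| ≤ ‖v s x‖ := fun x => by rw [← Real.norm_eq_abs]; exact PiLp.norm_apply_le (v s x) 0
  have hn1 : ∀ x, |v s x 1| ≤ ‖v s x‖ := fun x => by rw [← Real.norm_eq_abs]; exact PiLp.norm_apply_le (v s x) 1
  have g1 := hgen (fun x => v s x 0 * v s x 1) (EuclideanSpace.single 0 1) (EuclideanSpace.single 1 1) (ha.continuous.mul hb.continuous)
    (fun x => by
      rw [abs_mul, sq]
      exact mul_le_mul (hn0 x) (hn1 x) (abs_nonneg _) (norm_nonneg _)) he0 he1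
  have g2 := hgen (fun x => v s x 1 ^ 2) (EuclideanSpace.single 0 1) (EuclideanSpace.single 0 1) (hb.continuous.pow 2)
    (fun x => by
      rw [abs_of_nonneg (sq_nonneg _), ← sq_abs]
      exact pow_le_pow_left₀ (abs_nonneg _) (hn1 x) 2) he0 he0
  have g3 := hgen (fun x => v s x 0 ^ 2) (EuclideanSpace.single 1 1) (EuclideanSpace.single 1 1) (ha.continuous.pow 2)
    (fun x => by
      rw [abs_of_nonneg (sq_nonneg _), ← sq_abs]
      exact pow_le_pow_left₀ (abs_nonneg _) (hn0 x) 2) he1 he1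
  -- assemble
  have hR2 : C₂ / R ^ 2 * (K * (3 * R)) = 3 * C₂ * K / R := by
    field_simp
  rw [hR2] at g1 g2 g3
  have h1 := abs_le.1 g1
  have h2 := abs_le.1 g2
  have h3 := abs_le.1 g3
  have h4 := abs_le.1 he
  have hMR : (6 * C₂ * K + M₁ / 2) / R = 2 * (3 * C₂ * K / R) + 1 / 2 * (M₁ / R) := by
    field_simp
    ring
  rw [hMR, abs_le]
  constructor <;> linarith

/-! ### T1: the pairing collapse -/

/-- **STUB T1 (`stub_pairingCollapse`) — THE LEVER of LINE 9 `sonic_cut`**, statement VERBATIM from `Cruxes/PoloidalWindowRigidity/Lines/sonic_cut.lean`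
(l. 133–146): on a slice `s < 0` of a class profile, poloidal along `e₃`, the pairing `Q₃ = ∂₂v₀∂₀v₂ + ∂₂v₁∂₁v₂ + (∂₂v₂)²` cannot keep a sign
unless it vanishes identically.  Proof: `|∫ cutoff R · Q₃(s)| ≤ M/R` (`abs_integral_cutoff_mul_pairing_le_of_class`: `Q₃ = det ∇ₕvₕ + ½tr((Dv)²)`,
two null Lagrangians, S1) and the signed collapse `…SignedCollapse.eq_zero_of_sign_of_abs_integral_cutoff_mul_le`. [folklore] -/
theorem stub_pairingCollapse :
    ∀ (C : ℝ) (v : ℝ → EuclideanSpace ℝ (Fin 3) → EuclideanSpace ℝ (Fin 3)),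
      Literature.Analysis.FluidPDE.HasTypeITimeDecay C v →
      ContinuousOn (Function.uncurry v) (Set.Iio (0 : ℝ) ×ˢ Set.univ) →
      (∀ s t : ℝ, s < t → t < 0 → ∀ x, v t x =
        Literature.Analysis.UnboundedOperators.heatExtension (v s) (t - s) x -
          Literature.Analysis.FluidPDE.oseenDuhamel 1 s v v t x) →
      (∀ t < 0, Literature.Analysis.FluidPDE.VectorCalculus.IsDivFree (v t)) →
      (∀ s < 0, ∀ y, ⟪Literature.Analysis.FluidPDE.curl (v s) y, EuclideanSpace.single 2 1⟫_ℝ = 0) →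
      ∀ s : ℝ, s < 0 →
        ((∀ y : EuclideanSpace ℝ (Fin 3), 0 ≤ fderiv ℝ (v s) y (EuclideanSpace.single 2 1) 0 * fderiv ℝ (v s) y (EuclideanSpace.single 0 1) 2 + fderiv ℝ (v s) y (EuclideanSpace.single 2 1) 1 * fderiv ℝ (v s) y (EuclideanSpace.single 1 1) 2 + fderiv ℝ (v s) y (EuclideanSpace.single 2 1) 2 ^ 2) ∨
          (∀ y : EuclideanSpace ℝ (Fin 3), fderiv ℝ (v s) y (EuclideanSpace.single 2 1) 0 * fderiv ℝ (v s) y (EuclideanSpace.single 0 1) 2 + fderiv ℝ (v s) y (EuclideanSpace.single 2 1) 1 * fderiv ℝ (v s) y (EuclideanSpace.single 1 1) 2 + fderiv ℝ (v s) y (EuclideanSpace.single 2 1) 2 ^ 2 ≤ 0)) →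
        ∀ y : EuclideanSpace ℝ (Fin 3), fderiv ℝ (v s) y (EuclideanSpace.single 2 1) 0 * fderiv ℝ (v s) y (EuclideanSpace.single 0 1) 2 + fderiv ℝ (v s) y (EuclideanSpace.single 2 1) 1 * fderiv ℝ (v s) y (EuclideanSpace.single 1 1) 2 + fderiv ℝ (v s) y (EuclideanSpace.single 2 1) 2 ^ 2 = 0 := by
  intro C v hrate hcont hmild hdiv hpol s hs hsign
  obtain ⟨M, hM0, hM⟩ := abs_integral_cutoff_mul_pairing_le_of_class hrate hcont hmild hdiv hpol
  have h2s : 2 * s < 0 := by linarith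
  have hv2 : ContDiff ℝ 2 (v s) := by
    obtain ⟨p, hcl⟩ := (isTypeIAncientMild_of_class hrate hcont hmild hdiv).exists_isClassicalNSSolutionOn_Ioo h2s
    exact (hcl.contDiff_velocity ⟨by linarith, hs⟩).of_le (by norm_cast)
  have cA : ∀ i j : Fin 3, Continuous fun x => fderiv ℝ (v s) x (EuclideanSpace.single i 1) j := fun i j =>
    (contDiff_euclidean.1 ((hv2.fderiv_right (m := 0) (by norm_num)).clm_apply contDiff_const) j).continuous
  have hQc : Continuous fun y => fderiv ℝ (v s) y (EuclideanSpace.single 2 1) 0 * fderiv ℝ (v s) y (EuclideanSpace.single 0 1) 2 +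
      fderiv ℝ (v s) y (EuclideanSpace.single 2 1) 1 * fderiv ℝ (v s) y (EuclideanSpace.single 1 1) 2 +
      fderiv ℝ (v s) y (EuclideanSpace.single 2 1) 2 ^ 2 :=
    (((cA 2 0).mul (cA 0 2)).add ((cA 2 1).mul (cA 1 2))).add ((cA 2 2).pow 2)
  exact eq_zero_of_sign_of_abs_integral_cutoff_mul_le hQc hsign (hM s hs)

end Summit.NavierStokesRegularity.NavierStokesRegularity.Theorems.PoloidalWindowDoorPoloidalWindowRigidityPairingCollapse

end
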